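import Literature.NumberTheory.EllipticCurves.Kato2004.EllipticUnitKummerCupClass
import Literature.NumberTheory.EllipticCurves.Kato2004.KummerCupLevelClassConj
import HarnessLib

/-!
# Descent of the pushed, reduced Kummer–cup class of a unit tower to a normal subgroup:
# `g_* gα_* red_{p^k} (α_* w_U) = Cor_{H→U}(κ_H(β) ∪_ζ g(gα(e_k)))`

Curve-generic, prime-generic (number field `K`, Weierstrass curves `E′, E`, prime `p`).  For a Kummer frame `F` on `E′` with
unit tower `u` (T2 `KummerFrame`, `UnitTower`), its `T_pE′`-adic classes `w_U = F.tateClass u U` (T3a), an isogeny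
`α : E′ → E` with an additive lift `gα` on `p^k`-torsion, an endomorphism `φ` of `E` with additive lift `g`, and subgroups
`F.V s ≤ H ≤ U` (`H` open, of finite index in `U`, FIXING `ζ_k` and the point `e′ := g(gα(e_k))` — it need NOT fix `e_k`):
★ `KummerFrame.mapH1AddHom_reduceH1PkK_isogenyLayerMapK_tateClass` —
`g_*(red_{p^k}(α_* w_U)) = Cor_{H→U}(κ_H(β) ∪_{ζ_k} e′)` for every Kummer unit `β` of `H` with `β^{p^k} = ∏_{x ∈ H/V_s} t(x)·z_s`
(the norm of the unit `z_s` of the tower from `K̄^{V_s}` to `K̄^H`).  This is steps (m5)–(m6) of the (B2′) road (memo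
`Cruxes/EllipticUnitValueSevenOfGZK/K2C12KummerNonvanishing_g31.md`): reduce (`reduceH1PkK_tateClassAt`), push the isogeny
lifts through the corestrictions (`mapH1AddHom_reduceH1PkK_isogeny`, `mapH1AddHom_coresLe`) and INTO the Kummer–cup class at
the Kummer level `V_s` (L3 `mapH1AddHom_kummerCupLevelClass` — «apply `g₁_*` first»), then descend `V_s → H` as a Kummer–cup
class (T1b-1 `coresLe_kummerCupLevelClass_eq_of_pow_eq`), which is legitimate because `H` fixes `e′`.
Also `GaloisRepresentations.mapH1AddHom_comp` (composition of push-forwards).  Theorems only; no definition, no named fact.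

## References
* K. Kato, Astérisque 295 (2004), §8.2 (p. 181), (15.6.1) (p. 253), (15.12.1) (p. 263), 15.14 (p. 264). [Kato2004Asterisque]
* J. Neukirch, A. Schmidt, K. Wingberg, *Cohomology of Number Fields* (2008), I §5 Prop. 1.5.3 (iii), (1.5.7). [NeukirchSchmidtWingberg2008]
* J.-P. Serre, *Galois Cohomology* (1997), I §2.2–§2.4. [SerreGaloisCohomology1997]
-/

noncomputable section

open scoped NumberField
open Field IsDedekindDomain CategoryTheory
open Literature.NumberTheory.GaloisRepresentations
open Literature.NumberTheory.EllipticCurves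
open Literature.NumberTheory.EllipticCurves.Kato2004.CM (tateRepK)
open WeierstrassCurve (geomPoints geomTorsion)

universe u u' u'' v

/-! ## §1 Composition of push-forwards -/

namespace Literature.NumberTheory.GaloisRepresentations

section Comp

variable {R : Type u} [Ring R] [TopologicalSpace R] {R' : Type u'} [Ring R'] [TopologicalSpace R']
  {R'' : Type u''} [Ring R''] [TopologicalSpace R'']
variable {G : Type v} [Group G] [TopologicalSpace G] [IsTopologicalGroup G]
variable {X : TopRep.{v} R G} {Y : TopRep.{v} R' G} {Z : TopRep.{v} R'' G}

/-- **`g_* ∘ f_* = (g ∘ f)_*` on `H¹_cont`** (on cocycles both are `φ ↦ g ∘ f ∘ φ`). [cite: SerreGaloisCohomology1997, I §2.2] -/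
theorem mapH1AddHom_comp (f : X →+ Y) (hf : Continuous f) (hρf : ∀ (s : G) (x : X), f (X.ρ s x) = Y.ρ s (f x))
    (g : Y →+ Z) (hg : Continuous g) (hρg : ∀ (s : G) (y : Y), g (Y.ρ s y) = Z.ρ s (g y))
    (c : continuousCohomology 1 X) :
    mapH1AddHom Y Z g hg hρg (mapH1AddHom X Y f hf hρf c) =
      mapH1AddHom X Z (g.comp f) (hg.comp hf) (fun s x ↦ by rw [AddMonoidHom.comp_apply, hρf, hρg]; rfl) c := by
  obtain ⟨φ, rfl⟩ := oneCocycleClass_surjective _ c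
  rw [mapH1AddHom_oneCocycleClass, mapH1AddHom_oneCocycleClass, mapH1AddHom_oneCocycleClass]
  exact congrArg _ (Subtype.ext (ContinuousMap.ext fun _ ↦ rfl))

end Comp

end Literature.NumberTheory.GaloisRepresentations

/-! ## §2 The descent formula -/

namespace Literature.NumberTheory.EllipticCurves.Kato2004

open DiscreteGaloisModule

namespace KummerFrame

variable {K : Type} [Field K] [NumberField K] {E' E : WeierstrassCurve K} {p : ℕ} [Fact p.Prime]
  (F : KummerFrame E' p) (u : F.UnitTower)
  [E'.IsElliptic] [ContinuousSMul ℤ_[p] (E'.tateModule p)] [ContinuousSMul ℤ_[p] (E.tateModule p)]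

/-- ★ **Descent of the pushed, reduced class to a normal-layer Kummer–cup class.**  With the notation of the module docstring:
`g_*(red_{p^k}(α_* w_U)) = Cor_{H→U}(κ_H(β) ∪_{ζ_k} g(gα(e_k)))` whenever `F.V s ≤ H ≤ U` (`k ≤ s`), `H` open fixes `ζ_k` and
`g(gα(e_k))`, and `β^{p^k} = ∏_{x ∈ H/V_s} t(x)·z_s`.
[cite: Kato2004Asterisque, (15.6.1) (p. 253), (15.12.1) (p. 263) and 15.14 (p. 264)] [cite: NeukirchSchmidtWingberg2008, I §5 Prop. 1.5.3 (iii)] -/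
theorem mapH1AddHom_reduceH1PkK_isogenyLayerMapK_tateClass (α : WeierstrassCurve.Isogeny E' E) (k : ℕ)
    (gα : geomTorsion E' ((p : ℤ) ^ k) →+ geomTorsion E ((p : ℤ) ^ k))
    (hgα : ∀ P, ((gα P : geomTorsion E ((p : ℤ) ^ k)) : geomPoints E) = α (P : geomPoints E'))
    (φ : WeierstrassCurve.Isogeny E E) (g : geomTorsion E ((p : ℤ) ^ k) →+ geomTorsion E ((p : ℤ) ^ k))
    (hg : ∀ P, ((g P : geomTorsion E ((p : ℤ) ^ k)) : geomPoints E) = φ (P : geomPoints E))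
    {U H : Subgroup (absoluteGaloisGroup K)} (s : ℕ) (hks : k ≤ s) (hsH : F.V s ≤ H) (hHU : H ≤ U)
    (hHo : IsOpen (H : Set (absoluteGaloisGroup K))) [Fintype (U ⧸ H.subgroupOf U)]
    (hHζ : ∀ σ : H, (σ : absoluteGaloisGroup K) • F.ζ k = F.ζ k)
    (hHe : ∀ σ : H, (σ : absoluteGaloisGroup K) • g (gα (F.e k)) = g (gα (F.e k)))
    [Fintype (H ⧸ (F.V s).subgroupOf H)] {t : H ⧸ (F.V s).subgroupOf H → H}
    (ht : ∀ x, (t x : H ⧸ (F.V s).subgroupOf H) = x)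
    (β : subgroupKummerUnits K (p ^ k) H)
    (hβ : haveI : NeZero (p ^ k) := ⟨pow_ne_zero _ (Fact.out : p.Prime).ne_zero⟩
      (β : (AlgebraicClosure K)ˣ) ^ (p ^ k) = ∏ x, ((t x : H) : absoluteGaloisGroup K) • u.z s) :
    haveI : NeZero (p ^ k) := ⟨pow_ne_zero _ (Fact.out : p.Prime).ne_zero⟩
    mapH1AddHom (subgroupRep (E.torsionGaloisModule ((p : ℤ) ^ k)).toTopRep U)
        (subgroupRep (E.torsionGaloisModule ((p : ℤ) ^ k)).toTopRep U) g continuous_of_discreteTopology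
        (isogenyTorsion_subgroupRepK p k φ g hg U)
        (reduceH1PkK E p k U (isogenyLayerMapK p α U (F.tateClass u U))) =
      coresLe (E.torsionGaloisModule ((p : ℤ) ^ k)).toTopRep hHU hHo
        (kummerCupLevelClass E (p ^ k) H (F.ζ k) (F.isPrimitiveRoot_ζ k) (Nat.cast_pow p k) (g (gα (F.e k))) hHζ hHe β) := by
  haveI : NeZero (p ^ k) := ⟨pow_ne_zero _ (Fact.out : p.Prime).ne_zero⟩
  have hsU : F.V s ≤ U := hsH.trans hHU
  -- reduce: `red (α_* w_U) = gα_* (red w_U) = gα_* c_{U,k}`, `c_{U,k} = Cor_{V_s→U}(levelClass s k)`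
  rw [F.tateClass_of_le u U ⟨s, hsU⟩, ← mapH1AddHom_reduceH1PkK_isogeny p k α gα hgα U,
    F.reduceH1PkK_tateClassAt u U ⟨s, hsU⟩ k, F.classAtAny_eq_classAt u U ⟨s, hsU⟩ k s hks hsU, KummerFrame.classAt,
    ← CM.layerCores_trans _ hsH hHU (F.isOpen_V s) hHo, CM.layerCores_eq_coresLe _ hHU hHo,
    CM.layerCores_eq_coresLe _ hsH (F.isOpen_V s)]
  -- push `gα_*` and `g_*` through both corestrictions
  rw [mapH1AddHom_coresLe (X := (E'.torsionGaloisModule ((p : ℤ) ^ k)).toTopRep)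
      (Y := (E.torsionGaloisModule ((p : ℤ) ^ k)).toTopRep) gα continuous_of_discreteTopology hHU hHo
      (isogenyTorsion_subgroupRepK p k α gα hgα H) (isogenyTorsion_subgroupRepK p k α gα hgα U),
    mapH1AddHom_coresLe (X := (E.torsionGaloisModule ((p : ℤ) ^ k)).toTopRep)
      (Y := (E.torsionGaloisModule ((p : ℤ) ^ k)).toTopRep) g continuous_of_discreteTopology hHU hHo
      (isogenyTorsion_subgroupRepK p k φ g hg H) (isogenyTorsion_subgroupRepK p k φ g hg U),
    mapH1AddHom_coresLe (X := (E'.torsionGaloisModule ((p : ℤ) ^ k)).toTopRep)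
      (Y := (E.torsionGaloisModule ((p : ℤ) ^ k)).toTopRep) gα continuous_of_discreteTopology hsH (F.isOpen_V s)
      (isogenyTorsion_subgroupRepK p k α gα hgα (F.V s)) (isogenyTorsion_subgroupRepK p k α gα hgα H),
    mapH1AddHom_coresLe (X := (E.torsionGaloisModule ((p : ℤ) ^ k)).toTopRep)
      (Y := (E.torsionGaloisModule ((p : ℤ) ^ k)).toTopRep) g continuous_of_discreteTopology hsH (F.isOpen_V s)
      (isogenyTorsion_subgroupRepK p k φ g hg (F.V s)) (isogenyTorsion_subgroupRepK p k φ g hg H)]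
  -- at the Kummer level `V_s`: push the lifts INTO the Kummer–cup class (L3), then descend `V_s → H` (T1b-1)
  congr 1
  rw [KummerFrame.levelClass,
    mapH1AddHom_kummerCupLevelClass E' (p ^ k) (F.V s) (F.ζ k) (F.isPrimitiveRoot_ζ k) (Nat.cast_pow p k) (F.e k)
      (F.smul_ζ k s hks) (F.smul_e k s hks) (Nat.cast_pow p k) gα (isogenyTorsion_subgroupRepK p k α gα hgα (F.V s))
      (smul_map_eq_of_equivariant E' (F.V s) (F.e k) (F.smul_e k s hks) gα (isogenyTorsion_subgroupRepK p k α gα hgα (F.V s)))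
      (F.root u s k),
    mapH1AddHom_kummerCupLevelClass E (p ^ k) (F.V s) (F.ζ k) (F.isPrimitiveRoot_ζ k) (Nat.cast_pow p k) (gα (F.e k))
      (F.smul_ζ k s hks) _ (Nat.cast_pow p k) g (isogenyTorsion_subgroupRepK p k φ g hg (F.V s))
      (fun σ ↦ hHe ⟨(σ : absoluteGaloisGroup K), hsH σ.2⟩) (F.root u s k)]
  exact coresLe_kummerCupLevelClass_eq_of_pow_eq E (p ^ k) (F.ζ k) (F.isPrimitiveRoot_ζ k) (Nat.cast_pow p k)
    (g (gα (F.e k))) hsH (F.isOpen_V s) ht hHζ hHe (F.root u s k) β (by rw [hβ]; simp only [root_pow])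

end KummerFrame

end Literature.NumberTheory.EllipticCurves.Kato2004

end
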